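import Mathlib.LinearAlgebra.Trace
import Mathlib.LinearAlgebra.BilinearForm.Hom
import Mathlib.LinearAlgebra.BilinearForm.Orthogonal
import Literature.Geometry.Lorentzian.LorentzianMetric
import Literature.Geometry.Lorentzian.Hypersurface
import Literature.Geometry.Lorentzian.Volume
import Literature.Geometry.Riemannian.IsotropicCurvature
import HarnessLib

/-!
# Bel–Robinson (super)energy of a spacelike hypersurface

For a `C^n` pseudo-Riemannian metric `g` on `TM`, a covariant derivative `cov` on `TM` (meant:
a Levi-Civita connection of `g`, e.g. `g.leviCivita`), a point `x` and a tangent vector `u` at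
`x` (meant: a unit timelike vector, `g(u,u) = -1`) we define the **superenergy density**

  `W(u) = g.superenergyDensity cov x u = (1/8) |Rm|²_ĝ`,  `ĝ = g + 2 u♭ ⊗ u♭`,

the full contraction `ĝ^{aa'} ĝ^{bb'} ĝ^{cc'} ĝ^{dd'} R_{abcd} R_{a'b'c'd'}` of the lowered
curvature tensor `R_{abcd} = g(R(a,b)c, d)` with Senovilla's *positive-definite metric relative to
`u`*, `ĝ = g + 2u♭⊗u♭` (whose inverse is `ĝ⁻¹ = g⁻¹ + 2 u ⊗ u` when `g(u,u) = -1`). This is the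
superenergy density `W_R(u) = T{R}(u,u,u,u)` of the Riemann tensor in the sense of Senovilla
(2000), Def. 3.2 — the completely timelike component of the basic superenergy tensor `T{R}` of
the double `(2,2)`-form `R`, i.e. of the (generalized) **Bel tensor** (§6.1) — by his
Property 3.6 / Corollary 4.2 (`W_t(u) = ½ (Π 1/n_Υ!) |t|²_ĝ`, here `½ · ½ · ½ = 1/8`); in a
`ĝ`-orthonormal frame it is `(1/8) Σ_{abcd} R(e_a,e_b,e_c,e_d)²` (Property 3.5, proved below as
`LorentzianMetric.superenergyDensity_eq_sum_sq`), hence nonnegative (Property 3.4,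
`LorentzianMetric.superenergyDensity_nonneg`). In an Einstein space (`Ric = Λ g`, in particular
in vacuum) the Bel tensor coincides with the **Bel–Robinson tensor**
`Q = C ⊗ C + ⋆C ⊗ ⋆C` of the Weyl tensor `C = R` (Senovilla 2000, §6.1; Christodoulou–Klainerman
1993, Ch. 7, (7.1.4)), and `W(u) = Q(u,u,u,u) = |E|² + |B|²` with `E(X,Y) = g(R(X,u)u, Y)`,
`B(X,Y) = g(⋆R(X,u)u, Y)` the electric and magnetic parts (`E = i i_T W`, `H = i i_T ⋆W` of
Christodoulou–Klainerman 1993, §7.2, (7.2.1); frame count in a `ĝ`-orthonormal frame `e₀ = u`,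
in vacuum: `|Rm|²_ĝ = 4|E|² + 8|B|² + 4|E|² = 8(|E|² + |B|²)`).

For a spacelike immersion `f : N → M` with a field `ν` along `f` (meant: the future — or past,
the density is even in `u` — unit normal) and a set `A ⊆ N`, the **Bel–Robinson energy**

  `g.belRobinsonEnergy cov f ν hpb hf A = ∫⁻_{A} W(ν y) dμ_{f^*g}(y) ∈ ℝ≥0∞`

is the integral of the density against the Riemannian measure of the induced metric `f^* g`
(`riemannianMeasure`, `Volume.lean`) — in vacuum the flux of `Q(·, n, n, n)` through the slice,
Christodoulou–Klainerman 1993, Cor. 7.1.1.1 (`∫_{Σ_t} Q(W)(X,Y,Z,T) dμ_g` with `X = Y = Z = T`).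
`Spacetime.belRobinsonEnergy` is the specialisation to a spacetime with its Levi-Civita
connection.

## Contents

* `hatMetric g x u = ĝ = g + 2u♭⊗u♭`, `hatSharp g x u = ĝ⁻¹ = ♯_g + 2 u ⊗ u` (as a map
  `T*_xM → T_xM`; `hatMetric_hatSharp_apply`: it inverts `ĝ` when `g(u,u) = -1`), the `ĝ`-trace
  `hatTrace` and `ĝ`-pairing `hatPairing` of bilinear forms (through `ĝ⁻¹`, exactly as
  `PseudoRiemannianMetric.trace`/`normSq` go through `♯_g`; `hatTrace_zero`, `hatPairing_zero_self`);
* `curvatureBilin g cov x a b = R(a,b)♭ = g.curvatureForm cov x a b` (the tree's `Rm`,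
  `Riemannian/IsotropicCurvature.lean`), `hatCurvPair`, `hatCurvInner`, `hatCurvNormSq = |Rm|²_ĝ`
  (two bilinear layers, as for `curvNormSqWith` in `Riemannian/CurvatureNormSq.lean`),
  `superenergyDensity = (1/8)|Rm|²_ĝ`; evenness in `u`, vanishing for flat `cov`;
* frame expansion (`hatCurvNormSq_eq_sum_sq_of_frame`) and, for a Lorentzian metric and
  `g(u,u) = -1`: `ĝ` is positive definite (`LorentzianMetric.hatMetric_pos`), a `ĝ`-orthonormal
  frame exists (`LorentzianMetric.exists_hatFrame`), Senovilla's Properties 3.5 and 3.4;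
* `belRobinsonEnergy` (monotone in `A`, `∅ ↦ 0`, even in `ν`, `0` for flat `cov`) and
  `Spacetime.belRobinsonEnergy`.

## Mathlib / tree

Mathlib has no curvature, let alone superenergy tensors. From the tree we use
`PseudoRiemannianMetric` (`sharp`, `flat`, `trace`, `normSq`), `CovariantDerivative.curvature`
(`Curvature.lean`), `LorentzianMetric.pos_of_orthogonal`, `NormalField`,
`inducedRiemannianMetric`, `IsSpacelikeImmersion` (`Hypersurface.lean`), `riemannianMeasure`
(`Volume.lean`), `Spacetime`; from Mathlib `LinearMap.trace`, `Module.Basis`,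
`LinearMap.BilinForm.exists_orthogonal_basis`, `MeasureTheory.lintegral`.

## Design choices

* **Hodge-free form.** The density is *defined* as `(1/8)|Rm|²_ĝ` (Senovilla's Property 3.6),
  not as `|E|² + |B|²`: the magnetic part needs a Hodge dual on `u^⊥`, i.e. an orientation the
  slice need not carry, while `|Rm|²_ĝ` needs none and is meaningful in every dimension and for
  every `cov`. The identification with `Q(u,u,u,u) = |E|² + |B|²` in vacuum is the printed
  theorem quoted above and is not restated here.
* **No basis in the definitions.** `ĝ⁻¹` is the explicit map `hatSharp = ♯_g + 2 ev_u ⊗ u`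
  (correct inverse of `ĝ` exactly when `g(u,u) = -1`, `hatMetric_hatSharp_apply`; for other `u`
  the definitions still make sense but lose their meaning — e.g. `u = 0` gives back the plain
  `g`-contractions, `hatTrace_zero`), and all contractions are `LinearMap.trace`s through it, so
  no frame or chart is chosen; the frame formula is a theorem valid in *every* `ĝ`-orthonormal
  frame. A basis expansion in an arbitrary basis (for comparison with the coordinate expression
  `MetricCoord.tnormSq ĝ b (MetricCoord.rm4 G b)` of `CoordTensorCalculus.lean` /
  `CoordTensorRicciIdentity.lean`) follows the same lines and is left to the user who needs it.
* The connection is a parameter `cov` (as for `curvNormSqWith`), so that any Levi-Civita witness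
  `g.IsLeviCivita cov` can be used; `Spacetime.belRobinsonEnergy` takes `g.leviCivita` under the
  standing hypothesis `[HasLeviCivita]`. For a `g`-compatible `cov` the pairing
  `hatPairing (R(a,b)♭) (R(a',b')♭)` equals `-tr(θR(a,b) θR(a',b'))`, `θ = ĝ⁻¹ ∘ ♭_g`, but no
  curvature symmetry is used anywhere in this file.
* The energy is an extended nonnegative real (`∫⁻` of `ENNReal.ofReal ∘ W`); by
  `superenergyDensity_nonneg` nothing is lost by `ofReal` along a unit timelike normal of a
  Lorentzian manifold. Finiteness, measurability of `y ↦ W(ν y)` and smoothness are not needed to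
  define it and are not discussed. As in `Volume.lean`, `[T3Space N] [MeasurableSpace N]
  [BorelSpace N]` are instance hypotheses on the slice (a Hausdorff finite-dimensional manifold is
  `T3` by `Manifold.locallyCompact_of_finiteDimensional`).
* Not here: the Bel–Robinson / Bel *tensors* themselves, the dominant superenergy property,
  the divergence identities (Senovilla 2000, Thm. 6.1; Christodoulou–Klainerman 1993,
  Prop. 7.1.1), the `E`/`B` decomposition.

## References

* [Senovilla2000] J. M. M. Senovilla, *Super-energy tensors*, Class. Quantum Grav. 17 (2000)
  2799–2841, §3 (Def. 3.2, Properties 3.4–3.6), Cor. 4.2, §6.1 (numbering as in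
  arXiv:gr-qc/9906087).
* [ChristodoulouKlainerman1993] D. Christodoulou, S. Klainerman, *The global nonlinear stability
  of the Minkowski space*, Princeton 1993, Ch. 7: (7.1.4), Lemma 7.1.1, Cor. 7.1.1.1, §7.2 (7.2.1).
-/

noncomputable section

open Bundle Set Manifold MeasureTheory
open scoped ContDiff Topology ENNReal

namespace Literature.Geometry.Lorentzian

variable {E : Type*} [NormedAddCommGroup E] [NormedSpace ℝ E] {H : Type*} [TopologicalSpace H]
  {I : ModelWithCorners ℝ E H} {M : Type*} [TopologicalSpace M] [ChartedSpace H M]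
  {E' : Type*} [NormedAddCommGroup E'] [NormedSpace ℝ E'] {H' : Type*} [TopologicalSpace H']
  {I' : ModelWithCorners ℝ E' H'} {N : Type*} [TopologicalSpace N] [ChartedSpace H' N]
  [IsManifold I ∞ M] {n : ℕ∞ω}

namespace PseudoRiemannianMetric

variable (g : PseudoRiemannianMetric I n E (TangentSpace I : M → Type _))

/-! ### The positive-definite metric relative to `u` and its inverse -/

section Hat

/-- Senovilla's **positive-definite metric relative to `u`**: the bilinear form
`ĝ = g_x + 2 u♭ ⊗ u♭` on `T_x M`, `ĝ(v, w) = g(v,w) + 2 g(u,v) g(u,w)`. For a Lorentzian `g` and a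
unit timelike `u` it is positive definite (`LorentzianMetric.hatMetric_pos`).
[cite: Senovilla2000, §3, before Property 3.6 (h(u) = g + 2u⊗u)] -/
def hatMetric (x : M) (u : TangentSpace I x) : LinearMap.BilinForm ℝ (TangentSpace I x) :=
  g.toBilinForm x + (2 : ℝ) • LinearMap.BilinForm.linMulLin (g.flat x u) (g.flat x u)

/-- `ĝ(v, w) = g(v, w) + 2 g(u, v) g(u, w)`. [cite: Senovilla2000, §3, before Property 3.6] -/
@[simp]
lemma hatMetric_apply (x : M) (u v w : TangentSpace I x) :
    g.hatMetric x u v w = g.val x v w + 2 * (g.val x u v * g.val x u w) := by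
  simp [hatMetric]

/-- `ĝ` is symmetric. [cite: Senovilla2000, §3, before Property 3.6] -/
theorem hatMetric_isSymm (x : M) (u : TangentSpace I x) : (g.hatMetric x u).IsSymm :=
  ⟨fun v w ↦ by simp only [hatMetric_apply, g.symm x v w, mul_comm]⟩

variable [FiniteDimensional ℝ E]

/-- The **inverse `ĝ⁻¹ = g⁻¹ + 2 u ⊗ u`** of the positive-definite metric relative to `u`, as a
map `T*_x M → T_x M`: `α ↦ ♯_g α + 2 α(u) u`. It inverts `ĝ = g + 2u♭⊗u♭` exactly when
`g(u,u) = -1` (`hatMetric_hatSharp_apply`); for `u = 0` it is `♯_g` (`hatSharp_zero`).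
[cite: Senovilla2000, Property 3.6 (contraction with h^{μν})] -/
def hatSharp (x : M) (u : TangentSpace I x) :
    Module.Dual ℝ (TangentSpace I x) →ₗ[ℝ] TangentSpace I x :=
  (g.sharp x).toLinearMap + (2 : ℝ) • (Module.Dual.eval ℝ (TangentSpace I x) u).smulRight u

/-- `ĝ⁻¹ α = ♯α + 2 α(u) u`. [cite: Senovilla2000, Property 3.6] -/
@[simp]
lemma hatSharp_apply (x : M) (u : TangentSpace I x) (α : Module.Dual ℝ (TangentSpace I x)) :
    g.hatSharp x u α = g.sharp x α + (2 * α u) • u := by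
  simp [hatSharp, smul_smul]

/-- **`ĝ⁻¹` inverts `ĝ` for unit timelike `u`**: if `g(u,u) = -1` then `ĝ(ĝ⁻¹ α, w) = α(w)`
(`(g + 2u♭⊗u♭)(g⁻¹ + 2u⊗u) = 1 + 2u♭⊗u + 2u♭⊗u + 4 g(u,u) u♭⊗u = 1`).
[cite: Senovilla2000, Property 3.6] -/
lemma hatMetric_hatSharp_apply (x : M) {u : TangentSpace I x} (hu : g.val x u u = -1)
    (α : Module.Dual ℝ (TangentSpace I x)) (w : TangentSpace I x) :
    g.hatMetric x u (g.hatSharp x u α) w = α w := by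
  simp only [hatMetric_apply, hatSharp_apply, map_add, map_smul, LinearMap.add_apply,
    LinearMap.smul_apply, smul_eq_mul, val_sharp_apply]
  rw [g.symm x u (g.sharp x α), val_sharp_apply, hu]
  ring

/-- `ĝ⁻¹` for `u = 0` is `♯_g`. [folklore] -/
lemma hatSharp_zero (x : M) : g.hatSharp x 0 = (g.sharp x).toLinearMap := by
  ext α
  simp

/-- `ĝ⁻¹` only depends on `±u`. [folklore] -/
lemma hatSharp_neg (x : M) (u : TangentSpace I x) : g.hatSharp x (-u) = g.hatSharp x u := by
  ext α
  simp

/-- The **`ĝ`-trace** of a bilinear form `S` on `T_x M`: `tr_ĝ S = ĝ^{ab} S_{ab}`, the trace of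
`ĝ⁻¹ ∘ S : v ↦ ĝ⁻¹(S(v, ·))` (compare `PseudoRiemannianMetric.trace`, the case `u = 0`).
[cite: Senovilla2000, Property 3.6] -/
def hatTrace (x : M) (u : TangentSpace I x) (S : LinearMap.BilinForm ℝ (TangentSpace I x)) : ℝ :=
  LinearMap.trace ℝ (TangentSpace I x) (g.hatSharp x u ∘ₗ S)

/-- The **`ĝ`-pairing** of bilinear forms `S, S'` on `T_x M`:
`⟨S, S'⟩_ĝ = ĝ^{ac} ĝ^{bd} S_{ab} S'_{cd}`, the trace of `(ĝ⁻¹ ∘ S) ∘ (ĝ⁻¹ ∘ S'ᵗ)` (compare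
`PseudoRiemannianMetric.normSq`, the case `u = 0`, `S = S'`). [cite: Senovilla2000, Property 3.6] -/
def hatPairing (x : M) (u : TangentSpace I x) (S S' : LinearMap.BilinForm ℝ (TangentSpace I x)) :
    ℝ :=
  LinearMap.trace ℝ (TangentSpace I x) ((g.hatSharp x u ∘ₗ S) ∘ₗ (g.hatSharp x u ∘ₗ S'.flip))

/-- `tr_ĝ` is additive. [folklore] -/
lemma hatTrace_add (x : M) (u : TangentSpace I x) (S S' : LinearMap.BilinForm ℝ (TangentSpace I x)) :
    g.hatTrace x u (S + S') = g.hatTrace x u S + g.hatTrace x u S' := by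
  simp [hatTrace, LinearMap.comp_add]

/-- `tr_ĝ` is homogeneous. [folklore] -/
lemma hatTrace_smul (x : M) (u : TangentSpace I x) (c : ℝ)
    (S : LinearMap.BilinForm ℝ (TangentSpace I x)) :
    g.hatTrace x u (c • S) = c * g.hatTrace x u S := by
  simp [hatTrace, LinearMap.comp_smul]

/-- `⟨·, ·⟩_ĝ` is additive on the left. [folklore] -/
lemma hatPairing_add_left (x : M) (u : TangentSpace I x)
    (S₁ S₂ S' : LinearMap.BilinForm ℝ (TangentSpace I x)) :
    g.hatPairing x u (S₁ + S₂) S' = g.hatPairing x u S₁ S' + g.hatPairing x u S₂ S' := by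
  simp [hatPairing, LinearMap.comp_add, LinearMap.add_comp]

/-- `⟨·, ·⟩_ĝ` is homogeneous on the left. [folklore] -/
lemma hatPairing_smul_left (x : M) (u : TangentSpace I x) (c : ℝ)
    (S S' : LinearMap.BilinForm ℝ (TangentSpace I x)) :
    g.hatPairing x u (c • S) S' = c * g.hatPairing x u S S' := by
  simp [hatPairing, LinearMap.comp_smul, LinearMap.smul_comp]

/-- `⟨·, ·⟩_ĝ` is additive on the right. [folklore] -/
lemma hatPairing_add_right (x : M) (u : TangentSpace I x)
    (S S₁ S₂ : LinearMap.BilinForm ℝ (TangentSpace I x)) :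
    g.hatPairing x u S (S₁ + S₂) = g.hatPairing x u S S₁ + g.hatPairing x u S S₂ := by
  have hflip : (S₁ + S₂).flip = S₁.flip + S₂.flip := rfl
  simp [hatPairing, LinearMap.comp_add, hflip]

/-- `⟨·, ·⟩_ĝ` is homogeneous on the right. [folklore] -/
lemma hatPairing_smul_right (x : M) (u : TangentSpace I x) (c : ℝ)
    (S S' : LinearMap.BilinForm ℝ (TangentSpace I x)) :
    g.hatPairing x u S (c • S') = c * g.hatPairing x u S S' := by
  have hflip : (c • S').flip = c • S'.flip := rfl
  simp [hatPairing, LinearMap.comp_smul, hflip]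

/-- Sanity check: for `u = 0`, `tr_ĝ` is the metric trace `tr_g` of `PseudoRiemannianMetric.trace`.
[folklore] -/
lemma hatTrace_zero (x : M) (S : LinearMap.BilinForm ℝ (TangentSpace I x)) :
    g.hatTrace x 0 S = g.trace x S := by
  simp [hatTrace, trace, hatSharp_zero]

/-- Sanity check: for `u = 0`, `⟨S, S⟩_ĝ` is the metric square norm `PseudoRiemannianMetric.normSq`.
[folklore] -/
lemma hatPairing_zero_self (x : M) (S : LinearMap.BilinForm ℝ (TangentSpace I x)) :
    g.hatPairing x 0 S S = g.normSq x S := by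
  simp [hatPairing, normSq, hatSharp_zero]

end Hat

/-! ### The superenergy density `(1/8)|Rm|²_ĝ` -/

section Curv

variable (cov : CovariantDerivative I E (TangentSpace I : M → Type _))

/-- The **lowered curvature tensor** of `cov` at `x` with its first two slots fixed, as a
bilinear form: `curvatureBilin g cov x a b = R(a,b)♭ : (c, d) ↦ g(R(a,b)c, d) = R_{abcd}`, i.e.
`(c, d) ↦ g.curvatureForm cov x a b c d` (the tree's covariant curvature tensor,
`Riemannian/IsotropicCurvature.lean`; Lee's convention `Rm(X,Y,Z,W) = g(R(X,Y)Z, W)`;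
O'Neill 1983, Ch. 3, Lemma 3.35). [cite: ONeill1983, Ch. 3, Lemma 3.35] -/
def curvatureBilin (x : M) (a b : TangentSpace I x) : LinearMap.BilinForm ℝ (TangentSpace I x) :=
  (g.toBilinForm x) ∘ₗ ((cov.curvature x a b : TangentSpace I x →L[ℝ] TangentSpace I x) :
    TangentSpace I x →ₗ[ℝ] TangentSpace I x)

/-- `curvatureBilin g cov x a b c d = Rm(a,b,c,d) = g(R(a,b)c, d)`. [cite: ONeill1983, Ch. 3, Lemma 3.35] -/
@[simp]
lemma curvatureBilin_apply (x : M) (a b c d : TangentSpace I x) :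
    g.curvatureBilin cov x a b c d = g.curvatureForm cov x a b c d := rfl

/-- `Rm(a,b,c,d) = g(R(a,b)c, d)` (unfolding `curvatureForm`, for `simp`). [cite: ONeill1983, Ch. 3, Lemma 3.35] -/
lemma curvatureForm_apply' (x : M) (a b c d : TangentSpace I x) :
    g.curvatureForm cov x a b c d = g.val x (cov.curvature x a b c) d := rfl

/-- `R(a,b)♭` is additive in `a`. [folklore] -/
lemma curvatureBilin_add_left (x : M) (a₁ a₂ b : TangentSpace I x) :
    g.curvatureBilin cov x (a₁ + a₂) b = g.curvatureBilin cov x a₁ b + g.curvatureBilin cov x a₂ b := by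
  ext c d; simp [curvatureForm_apply']

/-- `R(a,b)♭` is homogeneous in `a`. [folklore] -/
lemma curvatureBilin_smul_left (x : M) (r : ℝ) (a b : TangentSpace I x) :
    g.curvatureBilin cov x (r • a) b = r • g.curvatureBilin cov x a b := by
  ext c d; simp [curvatureForm_apply']

/-- `R(a,b)♭` is additive in `b`. [folklore] -/
lemma curvatureBilin_add_right (x : M) (a b₁ b₂ : TangentSpace I x) :
    g.curvatureBilin cov x a (b₁ + b₂) = g.curvatureBilin cov x a b₁ + g.curvatureBilin cov x a b₂ := by
  ext c d; simp [curvatureForm_apply']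

/-- `R(a,b)♭` is homogeneous in `b`. [folklore] -/
lemma curvatureBilin_smul_right (x : M) (r : ℝ) (a b : TangentSpace I x) :
    g.curvatureBilin cov x a (r • b) = r • g.curvatureBilin cov x a b := by
  ext c d; simp [curvatureForm_apply']

variable [FiniteDimensional ℝ E]

/-- First contraction layer: for fixed `a, a'` the bilinear form
`(b, b') ↦ ⟨R(a,b)♭, R(a',b')♭⟩_ĝ = ĝ^{cc'} ĝ^{dd'} R_{abcd} R_{a'b'c'd'}` on `T_x M`.
[cite: Senovilla2000, Property 3.6] -/
def hatCurvPair (x : M) (u a a' : TangentSpace I x) : LinearMap.BilinForm ℝ (TangentSpace I x) :=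
  LinearMap.mk₂ ℝ
    (fun b b' ↦ g.hatPairing x u (g.curvatureBilin cov x a b) (g.curvatureBilin cov x a' b'))
    (fun b₁ b₂ b' ↦ by rw [curvatureBilin_add_right, hatPairing_add_left])
    (fun r b b' ↦ by rw [curvatureBilin_smul_right, hatPairing_smul_left, smul_eq_mul])
    (fun b b₁ b₂ ↦ by rw [curvatureBilin_add_right, hatPairing_add_right])
    (fun r b b' ↦ by rw [curvatureBilin_smul_right, hatPairing_smul_right, smul_eq_mul])

/-- Unfolding lemma for `hatCurvPair`. [folklore] -/
@[simp]
lemma hatCurvPair_apply (x : M) (u a a' b b' : TangentSpace I x) :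
    g.hatCurvPair cov x u a a' b b' =
      g.hatPairing x u (g.curvatureBilin cov x a b) (g.curvatureBilin cov x a' b') := rfl

/-- `hatCurvPair` is additive in `a`. [folklore] -/
lemma hatCurvPair_add_left (x : M) (u a₁ a₂ a' : TangentSpace I x) :
    g.hatCurvPair cov x u (a₁ + a₂) a' = g.hatCurvPair cov x u a₁ a' + g.hatCurvPair cov x u a₂ a' := by
  ext b b'
  simp only [hatCurvPair_apply, curvatureBilin_add_left, hatPairing_add_left, LinearMap.add_apply]

/-- `hatCurvPair` is homogeneous in `a`. [folklore] -/
lemma hatCurvPair_smul_left (x : M) (r : ℝ) (u a a' : TangentSpace I x) :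
    g.hatCurvPair cov x u (r • a) a' = r • g.hatCurvPair cov x u a a' := by
  ext b b'
  simp only [hatCurvPair_apply, curvatureBilin_smul_left, hatPairing_smul_left, LinearMap.smul_apply,
    smul_eq_mul]

/-- `hatCurvPair` is additive in `a'`. [folklore] -/
lemma hatCurvPair_add_right (x : M) (u a a₁ a₂ : TangentSpace I x) :
    g.hatCurvPair cov x u a (a₁ + a₂) = g.hatCurvPair cov x u a a₁ + g.hatCurvPair cov x u a a₂ := by
  ext b b'
  simp only [hatCurvPair_apply, curvatureBilin_add_left, hatPairing_add_right, LinearMap.add_apply]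

/-- `hatCurvPair` is homogeneous in `a'`. [folklore] -/
lemma hatCurvPair_smul_right (x : M) (r : ℝ) (u a a' : TangentSpace I x) :
    g.hatCurvPair cov x u a (r • a') = r • g.hatCurvPair cov x u a a' := by
  ext b b'
  simp only [hatCurvPair_apply, curvatureBilin_smul_left, hatPairing_smul_right, LinearMap.smul_apply,
    smul_eq_mul]

/-- Second contraction layer: the bilinear form
`(a, a') ↦ tr_ĝ [(b,b') ↦ ⟨R(a,b)♭, R(a',b')♭⟩_ĝ] = ĝ^{bb'} ĝ^{cc'} ĝ^{dd'} R_{abcd} R_{a'b'c'd'}`.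
[cite: Senovilla2000, Property 3.6] -/
def hatCurvInner (x : M) (u : TangentSpace I x) : LinearMap.BilinForm ℝ (TangentSpace I x) :=
  LinearMap.mk₂ ℝ (fun a a' ↦ g.hatTrace x u (g.hatCurvPair cov x u a a'))
    (fun a₁ a₂ a' ↦ by rw [hatCurvPair_add_left, hatTrace_add])
    (fun r a a' ↦ by rw [hatCurvPair_smul_left, hatTrace_smul, smul_eq_mul])
    (fun a a₁ a₂ ↦ by rw [hatCurvPair_add_right, hatTrace_add])
    (fun r a a' ↦ by rw [hatCurvPair_smul_right, hatTrace_smul, smul_eq_mul])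

/-- Unfolding lemma for `hatCurvInner`. [folklore] -/
@[simp]
lemma hatCurvInner_apply (x : M) (u a a' : TangentSpace I x) :
    g.hatCurvInner cov x u a a' = g.hatTrace x u (g.hatCurvPair cov x u a a') := rfl

/-- **The square norm `|Rm|²_ĝ` of the curvature of `cov` with respect to the positive-definite
metric relative to `u`**: `ĝ^{aa'} ĝ^{bb'} ĝ^{cc'} ĝ^{dd'} R_{abcd} R_{a'b'c'd'}` with
`R_{abcd} = g(R(a,b)c,d)` and `ĝ⁻¹ = g⁻¹ + 2u⊗u`, obtained as `tr_ĝ` of `hatCurvInner`. In a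
`ĝ`-orthonormal frame it is `Σ_{abcd} R(e_a,e_b,e_c,e_d)²` (`hatCurvNormSq_eq_sum_sq_of_frame`).
[cite: Senovilla2000, Properties 3.5–3.6] -/
def hatCurvNormSq (x : M) (u : TangentSpace I x) : ℝ :=
  g.hatTrace x u (g.hatCurvInner cov x u)

/-- **The superenergy density of the curvature relative to `u`**,
`W(u) = (1/8) |Rm|²_ĝ` with `ĝ = g + 2u♭⊗u♭` — Senovilla's `W_R(u) = T{R}(u,u,u,u)`, the totally
timelike component of the basic superenergy (Bel) tensor of the Riemann tensor (Def. 3.2 with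
Property 3.6 / Cor. 4.2: `W = ½ · (1/2!)(1/2!) |R|²_ĝ` for the double `(2,2)`-form `R`; §6.1).
Meant for `cov` a Levi-Civita connection of `g` and `u` unit timelike; in an Einstein space, in
particular in vacuum, it is the **Bel–Robinson superenergy density**
`Q(u,u,u,u) = |E|² + |B|²` (Senovilla 2000, §6.1; Christodoulou–Klainerman 1993, Ch. 7,
(7.1.4) and (7.2.1)). [cite: Senovilla2000, Def. 3.2, Property 3.6 and §6.1] -/
def superenergyDensity (x : M) (u : TangentSpace I x) : ℝ :=
  (1 / 8 : ℝ) * g.hatCurvNormSq cov x u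

/-- `hatCurvPair` only depends on `±u`. [folklore] -/
lemma hatCurvPair_neg (x : M) (u a a' : TangentSpace I x) :
    g.hatCurvPair cov x (-u) a a' = g.hatCurvPair cov x u a a' := by
  ext b b'
  simp only [hatCurvPair_apply, hatPairing, hatSharp_neg]

/-- `hatCurvInner` only depends on `±u`. [folklore] -/
lemma hatCurvInner_neg (x : M) (u : TangentSpace I x) :
    g.hatCurvInner cov x (-u) = g.hatCurvInner cov x u := by
  ext a a'
  simp only [hatCurvInner_apply, hatTrace, hatSharp_neg, hatCurvPair_neg]

/-- `|Rm|²_ĝ` only depends on `±u` (`ĝ` is quadratic in `u`). [folklore] -/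
lemma hatCurvNormSq_neg (x : M) (u : TangentSpace I x) :
    g.hatCurvNormSq cov x (-u) = g.hatCurvNormSq cov x u := by
  simp only [hatCurvNormSq, hatTrace, hatSharp_neg, hatCurvInner_neg]

/-- **The superenergy density is even in `u`**: `W(-u) = W(u)` (future and past unit normals
give the same density; Senovilla 2000, Def. 3.2 — an even number of contractions with `u`).
[cite: Senovilla2000, Def. 3.2] -/
lemma superenergyDensity_neg (x : M) (u : TangentSpace I x) :
    g.superenergyDensity cov x (-u) = g.superenergyDensity cov x u := by
  rw [superenergyDensity, superenergyDensity, hatCurvNormSq_neg]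

/-- `|Rm|²_ĝ` vanishes where the curvature tensor vanishes (Senovilla 2000, Property 3.4, the
trivial direction of `W = 0 ↔ R = 0`). [cite: Senovilla2000, Property 3.4] -/
lemma hatCurvNormSq_eq_zero_of_curvature (x : M) (u : TangentSpace I x) (h : cov.curvature x = 0) :
    g.hatCurvNormSq cov x u = 0 := by
  have h1 : ∀ a b, g.curvatureBilin cov x a b = 0 := fun a b ↦ by
    ext c d; simp [curvatureForm_apply', h]
  have h2 : ∀ a a', g.hatCurvPair cov x u a a' = 0 := fun a a' ↦ by
    ext b b'
    simp [h1, hatPairing]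
  have h3 : g.hatCurvInner cov x u = 0 := by
    ext a a'
    simp [h2, hatTrace]
  simp [hatCurvNormSq, h3, hatTrace]

/-- The superenergy density of a flat covariant derivative vanishes (e.g. Minkowski space).
[cite: Senovilla2000, Property 3.4] -/
lemma superenergyDensity_eq_zero_of_isFlat (h : cov.IsFlat) (x : M) (u : TangentSpace I x) :
    g.superenergyDensity cov x u = 0 := by
  simp [superenergyDensity, g.hatCurvNormSq_eq_zero_of_curvature cov x u (congrFun h x)]

end Curv

/-! ### Frame expansion (Senovilla's Property 3.5) -/

section Frame

variable [FiniteDimensional ℝ E] {g} {x : M} {u : TangentSpace I x} {ι : Type*} [Fintype ι]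
  (e : Module.Basis ι ℝ (TangentSpace I x))

omit [IsManifold I ∞ M] [FiniteDimensional ℝ E] in
/-- Coordinates of a basis expansion: `eⁱ(Σ_j c_j e_j) = c_i`. [folklore] -/
lemma coord_sum_smul_basis (c : ι → ℝ) (i : ι) : e.coord i (∑ j, c j • e j) = c i := by
  rw [Module.Basis.coord_apply, Module.Basis.repr_sum_self]

omit [IsManifold I ∞ M] [FiniteDimensional ℝ E] in
/-- The trace of an endomorphism of `T_x M` in a basis: `tr f = Σᵢ eⁱ(f eᵢ)`. [folklore] -/
lemma trace_eq_sum_coord_basis (f : TangentSpace I x →ₗ[ℝ] TangentSpace I x) :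
    LinearMap.trace ℝ (TangentSpace I x) f = ∑ i, e.coord i (f (e i)) := by
  classical
  rw [LinearMap.trace_eq_matrix_trace ℝ e, Matrix.trace]
  refine Finset.sum_congr rfl fun i _ ↦ ?_
  rw [Matrix.diag_apply, LinearMap.toMatrix_apply, Module.Basis.coord_apply]

variable (he : ∀ i, g.hatSharp x u (e.coord i) = e i)
include he

/-- In a frame `e` with `ĝ⁻¹ eⁱ = eᵢ` (a `ĝ`-orthonormal frame), `ĝ⁻¹ α = Σ_j α(e_j) e_j`.
[cite: Senovilla2000, Property 3.5] -/
lemma hatSharp_eq_sum_of_frame (α : Module.Dual ℝ (TangentSpace I x)) :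
    g.hatSharp x u α = ∑ j, α (e j) • e j := by
  conv_lhs => rw [← e.sum_dual_apply_smul_coord α]
  simp only [map_sum, map_smul, he]

/-- In a `ĝ`-orthonormal frame, `tr_ĝ S = Σᵢ S(eᵢ, eᵢ)`. [cite: Senovilla2000, Property 3.5] -/
lemma hatTrace_eq_sum_of_frame (S : LinearMap.BilinForm ℝ (TangentSpace I x)) :
    g.hatTrace x u S = ∑ i, S (e i) (e i) := by
  rw [hatTrace, trace_eq_sum_coord_basis e]
  refine Finset.sum_congr rfl fun i _ ↦ ?_
  rw [LinearMap.comp_apply, hatSharp_eq_sum_of_frame e he, coord_sum_smul_basis]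

/-- In a `ĝ`-orthonormal frame, `⟨S, S'⟩_ĝ = Σᵢⱼ S(eᵢ, eⱼ) S'(eᵢ, eⱼ)`.
[cite: Senovilla2000, Property 3.5] -/
lemma hatPairing_eq_sum_of_frame (S S' : LinearMap.BilinForm ℝ (TangentSpace I x)) :
    g.hatPairing x u S S' = ∑ i, ∑ j, S (e i) (e j) * S' (e i) (e j) := by
  rw [hatPairing, trace_eq_sum_coord_basis e]
  have h1 : ∀ i, (g.hatSharp x u ∘ₗ S'.flip) (e i) = ∑ j, S' (e j) (e i) • e j := fun i ↦ by
    rw [LinearMap.comp_apply, hatSharp_eq_sum_of_frame e he]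
    rfl
  have h2 : ∀ j, (g.hatSharp x u ∘ₗ S) (e j) = ∑ k, S (e j) (e k) • e k := fun j ↦ by
    rw [LinearMap.comp_apply, hatSharp_eq_sum_of_frame e he]
  have h3 : ∀ i, e.coord i (((g.hatSharp x u ∘ₗ S) ∘ₗ (g.hatSharp x u ∘ₗ S'.flip)) (e i)) =
      ∑ j, S' (e j) (e i) * S (e j) (e i) := fun i ↦ by
    rw [LinearMap.comp_apply, h1, map_sum, map_sum]
    refine Finset.sum_congr rfl fun j _ ↦ ?_
    rw [map_smul, map_smul, h2, coord_sum_smul_basis, smul_eq_mul]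
  simp only [h3]
  rw [Finset.sum_comm]
  exact Finset.sum_congr rfl fun j _ ↦ Finset.sum_congr rfl fun i _ ↦ mul_comm _ _

variable (cov : CovariantDerivative I E (TangentSpace I : M → Type _))

/-- **`|Rm|²_ĝ` in a `ĝ`-orthonormal frame is the sum of the squares of all components**:
`|Rm|²_ĝ = Σ_{abcd} g(R(e_a,e_b)e_c, e_d)²` (Senovilla 2000, Property 3.5, for `t = R`).
[cite: Senovilla2000, Property 3.5] -/
theorem hatCurvNormSq_eq_sum_sq_of_frame :
    g.hatCurvNormSq cov x u =
      ∑ a, ∑ b, ∑ c, ∑ d, g.curvatureForm cov x (e a) (e b) (e c) (e d) ^ 2 := by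
  rw [hatCurvNormSq, hatTrace_eq_sum_of_frame e he]
  refine Finset.sum_congr rfl fun a _ ↦ ?_
  rw [hatCurvInner_apply, hatTrace_eq_sum_of_frame e he]
  refine Finset.sum_congr rfl fun b _ ↦ ?_
  rw [hatCurvPair_apply, hatPairing_eq_sum_of_frame e he]
  simp only [curvatureBilin_apply, sq]

/-- `|Rm|²_ĝ ≥ 0` as soon as a `ĝ`-orthonormal frame exists. [cite: Senovilla2000, Property 3.4] -/
theorem hatCurvNormSq_nonneg_of_frame : 0 ≤ g.hatCurvNormSq cov x u := by
  rw [hatCurvNormSq_eq_sum_sq_of_frame e he]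
  exact Finset.sum_nonneg fun a _ ↦ Finset.sum_nonneg fun b _ ↦ Finset.sum_nonneg fun c _ ↦
    Finset.sum_nonneg fun d _ ↦ sq_nonneg _

end Frame

end PseudoRiemannianMetric

/-! ### Lorentzian metrics: positivity (Senovilla's Properties 3.4–3.5) -/

namespace LorentzianMetric

open PseudoRiemannianMetric

variable (g : LorentzianMetric I n M)

/-- **`ĝ = g + 2u♭⊗u♭` is positive definite for a unit timelike `u`**: writing
`v = w - g(u,v) u` with `w = v + g(u,v)u ⊥ u`, `ĝ(v,v) = g(w,w) + g(u,v)² > 0` for `v ≠ 0`,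
since `u^⊥` is spacelike (`pos_of_orthogonal`). Senovilla 2000, §3 ("as this is positive
definite …"). [cite: Senovilla2000, §3, before Property 3.6] -/
theorem hatMetric_pos (x : M) {u : TangentSpace I x} (hu : g.val x u u = -1)
    {v : TangentSpace I x} (hv : v ≠ 0) : 0 < g.hatMetric x u v v := by
  have huw : g.val x u (v + g.val x u v • u) = 0 := by
    rw [map_add, map_smul, smul_eq_mul, hu]; ring
  have hvu : g.val x v u = g.val x u v := g.symm x v u
  have hkey : g.hatMetric x u v v =
      g.val x (v + g.val x u v • u) (v + g.val x u v • u) + (g.val x u v) ^ 2 := by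
    simp only [hatMetric_apply, map_add, map_smul, _root_.add_apply,
      FunLike.coe_smul, Pi.smul_apply, smul_eq_mul, hu, hvu]
    ring
  rw [hkey]
  by_cases hw0 : v + g.val x u v • u = 0
  · have hc0 : g.val x u v ≠ 0 := by
      intro hc0
      apply hv
      rwa [hc0, zero_smul, add_zero] at hw0
    rw [hw0, map_zero, zero_add]
    positivity
  · have hpos : 0 < g.val x (v + g.val x u v • u) (v + g.val x u v • u) :=
      g.pos_of_orthogonal x u _ (by rw [hu]; norm_num) huw hw0
    positivity

variable [FiniteDimensional ℝ E]

/-- **Existence of a `ĝ`-orthonormal frame** for a unit timelike `u`: a basis `e` of `T_x M`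
with `ĝ(eᵢ, eⱼ) = δᵢⱼ` (Mathlib's `LinearMap.BilinForm.exists_orthogonal_basis`, normalised by
positivity), and then `ĝ⁻¹ eⁱ = eᵢ` (`ĝ⁻¹` inverts `ĝ`, `hatMetric_hatSharp_apply`, and `ĝ` is
nondegenerate). O'Neill 1983, Ch. 2, Lemma 2.24 ff.; Senovilla 2000, Property 3.5 (orthonormal
bases with `e₀ = u`; any `ĝ`-orthonormal basis will do). [cite: ONeill1983, Ch. 2, Lemma 2.24] -/
theorem exists_hatFrame (x : M) {u : TangentSpace I x} (hu : g.val x u u = -1) :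
    ∃ e : Module.Basis (Fin (Module.finrank ℝ (TangentSpace I x))) ℝ (TangentSpace I x),
      (∀ i j, g.hatMetric x u (e i) (e j) = if i = j then 1 else 0) ∧
      ∀ i, g.hatSharp x u (e.coord i) = e i := by
  classical
  haveI : FiniteDimensional ℝ (TangentSpace I x) := inferInstanceAs (FiniteDimensional ℝ E)
  set B := g.hatMetric x u with hB
  have hpos : ∀ v, v ≠ 0 → 0 < B v v := fun v hv ↦ g.hatMetric_pos x hu hv
  have hsymm : LinearMap.IsSymm B := LinearMap.isSymm_def.mpr fun v w ↦ by
    rw [RingHom.id_apply]; exact (g.hatMetric_isSymm x u).eq v w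
  obtain ⟨v, hv⟩ := LinearMap.BilinForm.exists_orthogonal_basis hsymm
  have hvpos : ∀ i, 0 < B (v i) (v i) := fun i ↦ hpos _ (v.ne_zero i)
  set w : Fin (Module.finrank ℝ (TangentSpace I x)) → ℝ :=
    fun i ↦ (Real.sqrt (B (v i) (v i)))⁻¹ with hw
  have hwpos : ∀ i, 0 < w i := fun i ↦ inv_pos.mpr (Real.sqrt_pos.mpr (hvpos i))
  have hwu : ∀ i, IsUnit (w i) := fun i ↦ (hwpos i).ne'.isUnit
  set e := v.isUnitSMul hwu with he_def
  have he : ∀ i j, B (e i) (e j) = if i = j then 1 else 0 := by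
    intro i j
    simp only [he_def, Module.Basis.isUnitSMul_apply, map_smul, LinearMap.smul_apply, smul_eq_mul]
    by_cases hij : i = j
    · subst hij
      simp only [if_true, hw]
      have h := hvpos i
      have hsq : Real.sqrt (B (v i) (v i)) ^ 2 = B (v i) (v i) := Real.sq_sqrt h.le
      field_simp
      linarith [hsq]
    · simp only [hij, if_false]
      have h0 : B (v i) (v j) = 0 := hv hij
      rw [h0, mul_zero, mul_zero]
  refine ⟨e, he, fun i ↦ ?_⟩
  have hnd : ∀ d : TangentSpace I x, (∀ j, B d (e j) = 0) → d = 0 := fun d hd ↦ by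
    by_contra hne
    have hBd : B d = 0 := e.ext fun j ↦ by rw [hd j, LinearMap.zero_apply]
    have h0 : B d d = 0 := by rw [hBd, LinearMap.zero_apply]
    exact (hpos d hne).ne' h0
  have key : ∀ j, B (g.hatSharp x u (e.coord i) - e i) (e j) = 0 := fun j ↦ by
    rw [map_sub, LinearMap.sub_apply, hB, g.hatMetric_hatSharp_apply x hu, ← hB, he i j,
      Module.Basis.coord_apply, Module.Basis.repr_self, Finsupp.single_apply]
    by_cases hij : i = j
    · subst hij; simp
    · rw [if_neg (Ne.symm hij), if_neg hij, sub_zero]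
  exact sub_eq_zero.mp (hnd _ key)

/-- **Nonnegativity of the superenergy density** (Senovilla 2000, Property 3.4): for a
Lorentzian metric, any covariant derivative `cov` on `TM` and a unit timelike `u`,
`0 ≤ W(u) = (1/8)|Rm|²_ĝ` (a sum of squares in a `ĝ`-orthonormal frame). Compare
Christodoulou–Klainerman 1993, Lemma 7.1.1 (2). [cite: Senovilla2000, Property 3.4] -/
theorem superenergyDensity_nonneg (cov : CovariantDerivative I E (TangentSpace I : M → Type _))
    (x : M) {u : TangentSpace I x} (hu : g.val x u u = -1) :
    0 ≤ g.superenergyDensity cov x u := by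
  obtain ⟨e, -, he⟩ := g.exists_hatFrame x hu
  have h := hatCurvNormSq_nonneg_of_frame e he cov
  unfold PseudoRiemannianMetric.superenergyDensity
  positivity

/-- **The superenergy density in a `ĝ`-orthonormal frame** (Senovilla 2000, Property 3.5, for
the Riemann tensor): if `g(u,u) = -1` and `ĝ(eᵢ, eⱼ) = δᵢⱼ` then
`W(u) = (1/8) Σ_{abcd} g(R(e_a,e_b)e_c, e_d)²` — "half the sum of the squares of all the
components", the components of the double `(2,2)`-form `R` being the `R_{[ab][cd]}`, `a < b`,
`c < d`. [cite: Senovilla2000, Property 3.5] -/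
theorem superenergyDensity_eq_sum_sq (cov : CovariantDerivative I E (TangentSpace I : M → Type _))
    (x : M) {u : TangentSpace I x} (hu : g.val x u u = -1) {ι : Type*} [Fintype ι] [DecidableEq ι]
    (e : Module.Basis ι ℝ (TangentSpace I x))
    (he : ∀ i j, g.hatMetric x u (e i) (e j) = if i = j then 1 else 0) :
    g.superenergyDensity cov x u =
      (1 / 8 : ℝ) * ∑ a, ∑ b, ∑ c, ∑ d, g.curvatureForm cov x (e a) (e b) (e c) (e d) ^ 2 := by
  have hpos : ∀ v, v ≠ 0 → 0 < g.hatMetric x u v v := fun v hv ↦ g.hatMetric_pos x hu hv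
  have hnd : ∀ d : TangentSpace I x, (∀ j, g.hatMetric x u d (e j) = 0) → d = 0 := fun d hd ↦ by
    by_contra hne
    have hBd : g.hatMetric x u d = 0 := e.ext fun j ↦ by rw [hd j, LinearMap.zero_apply]
    have h0 : g.hatMetric x u d d = 0 := by rw [hBd, LinearMap.zero_apply]
    exact (hpos d hne).ne' h0
  have he' : ∀ i, g.hatSharp x u (e.coord i) = e i := fun i ↦ by
    have key : ∀ j, g.hatMetric x u (g.hatSharp x u (e.coord i) - e i) (e j) = 0 := fun j ↦ by
      rw [map_sub, LinearMap.sub_apply, g.hatMetric_hatSharp_apply x hu, he i j,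
        Module.Basis.coord_apply, Module.Basis.repr_self, Finsupp.single_apply]
      by_cases hij : i = j
      · subst hij; simp
      · rw [if_neg (Ne.symm hij), if_neg hij, sub_zero]
    exact sub_eq_zero.mp (hnd _ key)
  rw [PseudoRiemannianMetric.superenergyDensity, hatCurvNormSq_eq_sum_sq_of_frame e he' cov]

end LorentzianMetric

/-! ### The Bel–Robinson energy of a spacelike hypersurface -/

namespace PseudoRiemannianMetric

section Slice

variable (g : PseudoRiemannianMetric I n E (TangentSpace I : M → Type _)) [FiniteDimensional ℝ E]
  (cov : CovariantDerivative I E (TangentSpace I : M → Type _))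
  [FiniteDimensional ℝ E'] [IsManifold I' ∞ N] [T3Space N] [MeasurableSpace N] [BorelSpace N]

/-- **The Bel–Robinson (super)energy of a set `A ⊆ N` on the spacelike immersed hypersurface
`f : N → M` with respect to the field `ν` along `f`** (meant: the future unit normal,
`g(ν,ν) = -1`, `ν ⊥ df`; the value is the same for `-ν`, `belRobinsonEnergy_neg`):
`∫⁻_{y ∈ A} W(ν y) dμ_{f^*g}(y) ∈ ℝ≥0∞`, the integral of the superenergy density
`W = (1/8)|Rm|²_ĝ` of `cov` (meant: a Levi-Civita connection of `g`) against the Riemannian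
measure of the induced metric `f^* g` (`riemannianMeasure` of `inducedRiemannianMetric`;
hypotheses `hpb`, `hf` as there). In vacuum this is `∫_A Q(n,n,n,n) dμ_h`, the Bel–Robinson
energy of the slice (Christodoulou–Klainerman 1993, Cor. 7.1.1.1 with `X = Y = Z = T`; Senovilla
2000, Def. 3.2 and §6.1). [cite: ChristodoulouKlainerman1993, Ch. 7, (7.1.4) and Cor. 7.1.1.1] -/
def belRobinsonEnergy (f : N → M) (ν : NormalField I f)
    (hpb : contMDiff_pullbackBilin I M I' N n) (hf : g.IsSpacelikeImmersion I' f) (A : Set N) :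
    ℝ≥0∞ :=
  ∫⁻ y in A, ENNReal.ofReal (g.superenergyDensity cov (f y) (ν y))
    ∂(riemannianMeasure (g.inducedRiemannianMetric f hpb hf))

variable {g cov}

/-- Unfolding lemma for `belRobinsonEnergy`. [folklore] -/
lemma belRobinsonEnergy_eq {f : N → M} (ν : NormalField I f)
    (hpb : contMDiff_pullbackBilin I M I' N n) (hf : g.IsSpacelikeImmersion I' f) (A : Set N) :
    g.belRobinsonEnergy cov f ν hpb hf A =
      ∫⁻ y in A, ENNReal.ofReal (g.superenergyDensity cov (f y) (ν y))
        ∂(riemannianMeasure (g.inducedRiemannianMetric f hpb hf)) := rfl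

/-- The Bel–Robinson energy is monotone in the set. [folklore] -/
lemma belRobinsonEnergy_mono {f : N → M} (ν : NormalField I f)
    (hpb : contMDiff_pullbackBilin I M I' N n) (hf : g.IsSpacelikeImmersion I' f) {A B : Set N}
    (h : A ⊆ B) : g.belRobinsonEnergy cov f ν hpb hf A ≤ g.belRobinsonEnergy cov f ν hpb hf B :=
  lintegral_mono' (Measure.restrict_mono h le_rfl) le_rfl

/-- The Bel–Robinson energy of the empty set vanishes. [folklore] -/
@[simp]
lemma belRobinsonEnergy_empty {f : N → M} (ν : NormalField I f)
    (hpb : contMDiff_pullbackBilin I M I' N n) (hf : g.IsSpacelikeImmersion I' f) :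
    g.belRobinsonEnergy cov f ν hpb hf ∅ = 0 := by
  simp [belRobinsonEnergy]

/-- The Bel–Robinson energy does not depend on the sign of the normal (`W(-u) = W(u)`).
[cite: Senovilla2000, Def. 3.2] -/
lemma belRobinsonEnergy_neg {f : N → M} (ν : NormalField I f)
    (hpb : contMDiff_pullbackBilin I M I' N n) (hf : g.IsSpacelikeImmersion I' f) (A : Set N) :
    g.belRobinsonEnergy cov f (-ν) hpb hf A = g.belRobinsonEnergy cov f ν hpb hf A := by
  simp [belRobinsonEnergy, superenergyDensity_neg]

/-- Slices of a flat manifold (e.g. Minkowski space) carry no Bel–Robinson energy.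
[cite: Senovilla2000, Property 3.4] -/
lemma belRobinsonEnergy_eq_zero_of_isFlat (hflat : cov.IsFlat) {f : N → M} (ν : NormalField I f)
    (hpb : contMDiff_pullbackBilin I M I' N n) (hf : g.IsSpacelikeImmersion I' f) (A : Set N) :
    g.belRobinsonEnergy cov f ν hpb hf A = 0 := by
  simp [belRobinsonEnergy, g.superenergyDensity_eq_zero_of_isFlat cov hflat]

end Slice

end PseudoRiemannianMetric

namespace Spacetime

variable {d : ℕ}

/-- **The Bel–Robinson energy of a set `A` on a spacelike hypersurface `f : S → 𝓢` of a
spacetime**, with respect to the field `ν` along `f` (meant: the future unit normal,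
`𝓢.metric.IsFutureUnitNormal I' 𝓢.timeOrientation f ν`): `∫⁻_A Q(ν,ν,ν,ν) dμ_{f^*g}` with the
curvature of the Levi-Civita connection of `𝓢` (standing hypothesis `[HasLeviCivita]`),
`PseudoRiemannianMetric.belRobinsonEnergy` for `cov = g.leviCivita`. For `d = 4` and vacuum this
is the classical Bel–Robinson energy `∫ (|E|² + |B|²)`. [cite: ChristodoulouKlainerman1993, Ch. 7, (7.1.4) and Cor. 7.1.1.1] -/
def belRobinsonEnergy (𝓢 : Spacetime d) [𝓢.metric.HasLeviCivita]
    {S : Type*} [TopologicalSpace S] [ChartedSpace H' S] [IsManifold I' ∞ S] [T3Space S]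
    [MeasurableSpace S] [BorelSpace S] [FiniteDimensional ℝ E']
    (f : S → 𝓢.carrier) (ν : NormalField (𝓡 d) f)
    (hpb : PseudoRiemannianMetric.contMDiff_pullbackBilin (𝓡 d) 𝓢.carrier I' S ∞)
    (hf : 𝓢.metric.IsSpacelikeImmersion I' f) (A : Set S) : ℝ≥0∞ :=
  𝓢.metric.toPseudoRiemannianMetric.belRobinsonEnergy 𝓢.metric.leviCivita f ν hpb hf A

/-- Unfolding lemma for `Spacetime.belRobinsonEnergy`. [folklore] -/
lemma belRobinsonEnergy_eq (𝓢 : Spacetime d) [𝓢.metric.HasLeviCivita]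
    {S : Type*} [TopologicalSpace S] [ChartedSpace H' S] [IsManifold I' ∞ S] [T3Space S]
    [MeasurableSpace S] [BorelSpace S] [FiniteDimensional ℝ E']
    (f : S → 𝓢.carrier) (ν : NormalField (𝓡 d) f)
    (hpb : PseudoRiemannianMetric.contMDiff_pullbackBilin (𝓡 d) 𝓢.carrier I' S ∞)
    (hf : 𝓢.metric.IsSpacelikeImmersion I' f) (A : Set S) :
    𝓢.belRobinsonEnergy f ν hpb hf A =
      𝓢.metric.toPseudoRiemannianMetric.belRobinsonEnergy 𝓢.metric.leviCivita f ν hpb hf A := rfl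

/-- The Bel–Robinson energy of a spacetime slice along a unit timelike field has a nonnegative
integrand: `0 ≤ W(ν y)` for `g(ν y, ν y) = -1` (Senovilla 2000, Property 3.4).
[cite: Senovilla2000, Property 3.4] -/
lemma superenergyDensity_nonneg (𝓢 : Spacetime d) [𝓢.metric.HasLeviCivita]
    (x : 𝓢.carrier) {u : TangentSpace (𝓡 d) x} (hu : 𝓢.metric.val x u u = -1) :
    0 ≤ 𝓢.metric.superenergyDensity 𝓢.metric.leviCivita x u :=
  𝓢.metric.superenergyDensity_nonneg _ x hu

end Spacetime

end Literature.Geometry.Lorentzian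

end
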